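import Literature.Probability.RandomPlanarGeometry.HexSAWSurfaceWallRenewalSlackFourFourDownRunsReturn
import Literature.Probability.RandomPlanarGeometry.HexSAWSurfaceWallRenewalSlackFourFourDownGeometry
import Literature.Probability.RandomPlanarGeometry.HexSAWSurfaceWallRenewalSlackFourFourDownReturnHyp
import Literature.Probability.RandomPlanarGeometry.HexSAWSurfaceWallRenewalSlackFourFourDownFamiliesShallow
import HarnessLib

/-!
# Hexagonal-lattice SAWs at a surface: slack four — the four-down order returning to the wall: geometry to table walk

Wall-renewal blocks of the brick-wall (hexagonal) half-plane walk (`ipwb m`) at slack four, `m = 6k + 4` with `k`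
visits, with four down steps in the order `D D U U D D U U` — the order whose fourth run lies on the wall
(`dduudduu4_runs`, `…SlackFourFourDownRunsReturn`; system, shields and table in `…SlackFourFourDownReturnHyp`). This
module derives the system from the geometry and identifies the blocks with the table walks of family B5 (`s4j`,
`…SlackFourFourDownFamiliesShallow`):

* `dduudduu4_hyp` — for every such block with `k ≥ 2` the step columns `c₁ … c₇` are natural numbers, the visit
  count reads `p₁ + p₃ + m = r₂ + r₄ + 2k + 2`, and
  `Dduudduu4Hyp k p₁ (m − r₄ − 1) (t₂ − t₁ − 1) … (t₈ − t₇ − 1) c₁ … c₇` holds — the order-free lemmas of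
  `…SlackFourFourDownGeometry` (shields low/high, `row_runs_apart`, `resurface_right_of_initial_run`) and of
  `…ReturnHyp` (`wall_point_right_of_initial_run`, `four_down_shield_mid` at every even column strictly inside the
  middle run, the time parity read off `parity_apply`).

* `dduudduu4_table_j` — a walk with the runs, signs and step times of `s4j k a` coincides with it up to time
  `6k + 4`.

* `dduudduu4_eq_s4j` — a block whose run data satisfy the system and the table IS `s4j k a` for some `1 ≤ a ≤ k − 2`
  (`eq_tab_walk_of_forall`).

STATUS: lane theorems of the a-idea-1 bridge/renewal lineage, car 100 «four-down wall return: geometry to table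
walk» — with `…ReturnHyp` the B5 branch (`k − 2` blocks) of the classification of the four-down stratum of the
slack-four row (FINDING-HEX-WALL-SLACK-FOUR-LAW: `12·#{#stepsD = 4} = (k−2)(2k⁴ − 7k³ + 4k² + 7k + 6)`); the law
assembles the five orders next. OURS (elementary). Sources: the renewal / irreducible-bridge structure [MS]
Madras–Slade §4.2 (Definition 4.2.1, p. 90; remark before (4.2.21), p. 94), the brick-wall frame [EJ] Enting–Jensen
§7.4.2, Fig. 7.10 — neither contains these statements.
-/

namespace Literature.Probability.RandomPlanarGeometry.SAW.HexBW.Wall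

open Finset Filter Function
open Literature.Probability.LatticeModels Literature.Probability.Percolation SimpleGraph

variable {ω : ℕ → Site 2}

/-- Two coordinates determine a site of `ℤ²` (plumbing). [folklore] -/
private theorem site_ext_d4j {p q : Site 2} (h0 : p 0 = q 0) (h1 : p 1 = q 1) : p = q := by
  funext i
  fin_cases i
  · exact h0
  · exact h1

/-- **The constraint system of a `D D U U D D U U` block at slack four.** For an irreducible positive wall bridge of
length `6k + 4` (`k ≥ 2`) with `k` wall visits and vertical steps in the order `D D U U D D U U` (down times
`p₁ < p₂ < p₃ < p₄`, up times `r₁ < r₂ < r₃ < r₄`, `p₂ < r₁`, `r₂ < p₃`, `p₄ < r₃`), the columns `c₁ … c₇` of the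
vertical steps 2, …, 8 are natural numbers and, with `p = p₁`, `f = m − r₄ − 1` and the run lengths
`hⱼ = tⱼ₊₁ − tⱼ − 1`, satisfy `Dduudduu4Hyp` (`…SlackFourFourDownReturnHyp`): LEN, VIS
(`p₁ + p₃ + m = r₂ + r₄ + 2k + 2`), PAR, positive runs, SIGNS (the runs of `dduudduu4_runs`), ROWS (runs 1, 3, 5, 7
on row `−1`, runs 2, 6 on row `−2`: `row_runs_apart` + self-avoidance; on the wall row the middle run against the
final run likewise and against the initial run by `wall_point_right_of_initial_run`), WALL
(`resurface_right_of_initial_run`), XRNG (bridge), IRR (`four_down_shield_low/high/mid`, the middle one at every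
even column inside run 4 via `parity_apply`). The proof of `dddduuuu4_hyp` (`…SlackFourFourDownSystems`) with three
more fields. OURS. [cite: MadrasSlade1993, §4.2, Definition 4.2.1 (p. 90), remark before (4.2.21) (p. 94)]
[cite: EntingJensen2009, §7.4.2, Fig. 7.10] -/
theorem dduudduu4_hyp {k m : ℕ}
    (hk : 2 ≤ k) (hm : m = 6 * k + 4) (hω : ω ∈ ipwb m) (hv : visits m ω = k) {p₁ p₂ p₃ p₄ r₁ r₂ r₃ r₄ : ℕ}
    (hD : stepsD m ω = {p₁, p₂, p₃, p₄}) (hU : stepsU m ω = {r₁, r₂, r₃, r₄}) (h12 : p₁ < p₂) (h23 : p₂ < p₃)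
    (h34 : p₃ < p₄) (hr12 : r₁ < r₂) (hr23 : r₂ < r₃) (hr34 : r₃ < r₄) (ht2 : p₂ < r₁) (ht4 : r₂ < p₃) (ht6 : p₄ < r₃)
    (hp1 : 1 ≤ p₁) (hR0 : ∀ i, i ≤ p₁ → ω i 0 = i ∧ ω i 1 = 0) (hP1x : ω (p₁ + 1) 0 = p₁) (hP1y : ω (p₁ + 1) 1 = -1)
    (hhor : ∀ i, i < m → i ∉ stepsD m ω → i ∉ stepsU m ω → ω (i + 1) 1 = ω i 1 ∧
        (ω (i + 1) 0 = ω i 0 + 1 ∨ ω (i + 1) 0 = ω i 0 - 1)) :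
    ∃ c1 c2 c3 c4 c5 c6 c7 : ℕ, (c1 : ℤ) = ω p₂ 0 ∧ (c2 : ℤ) = ω r₁ 0 ∧ (c3 : ℤ) = ω r₂ 0 ∧ (c4 : ℤ) = ω p₃ 0 ∧
      (c5 : ℤ) = ω p₄ 0 ∧ (c6 : ℤ) = ω r₃ 0 ∧ (c7 : ℤ) = ω r₄ 0 ∧ p₁ + p₃ + m = r₂ + r₄ + 2 * k + 2 ∧
      Dduudduu4Hyp k p₁ (m - r₄ - 1) (p₂ - p₁ - 1) (r₁ - p₂ - 1) (r₂ - r₁ - 1) (p₃ - r₂ - 1) (p₄ - p₃ - 1)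
          (r₃ - p₄ - 1) (r₄ - r₃ - 1) c1 c2 c3 c4 c5 c6 c7 := by
  classical
  obtain ⟨hpw, hn1, hirr⟩ := mem_ipwb.1 hω
  obtain ⟨hw, hbr⟩ := mem_pwb.1 hpw
  obtain ⟨ha, -⟩ := mem_wbr.1 hw
  obtain ⟨hh, -, -⟩ := mem_archs.1 ha
  obtain ⟨hs, hhp⟩ := mem_hpw.1 hh
  obtain ⟨h0, -, hbw, hinj⟩ := mem_saws_iff.1 hs
  have hX0 : ω 0 0 = 0 := by rw [h0]; rfl
  have hb' : ∀ i, 1 ≤ i → i ≤ m → 0 < ω i 0 ∧ ω i 0 ≤ ω m 0 := fun i h1 h2 => by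
    have := hbr i h1 h2; rwa [hX0] at this
  have hmem : ∀ i, i ≤ m → i ∈ {i | i ≤ m} := fun i hi => hi
  have hmD : ∀ i, i ∈ stepsD m ω ↔ i = p₁ ∨ i = p₂ ∨ i = p₃ ∨ i = p₄ := fun i => by
    rw [hD]; simp only [Finset.mem_insert, Finset.mem_singleton]
  obtain ⟨-, -, -, hppar1⟩ := of_mem_stepsD_coord hbw (i := p₁) ((hmD _).2 (by simp))
  have hpodd : p₁ % 2 = 1 := by rw [hP1x, hP1y] at hppar1; omega
  obtain ⟨e₁, e₂, e₃, e₄, e₅, e₆, e₇, he₁, he₂, he₃, he₄, he₅, he₆, he₇, hrun1, hrun2, hrun3, hrun4, hrun5,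
      hrun6, hrun7, hR8, hs_eq, hN, hq2, hq3, hq4, hq5, hq6, hq7, hq8, hx2, hx3, hx4, hx5, hx6, hx7,
      hg1, hg2, hg4, hg5, hg6, hr4m⟩ :=
    dduudduu4_runs hm hω hv hD hU h12 h23 h34 hr12 hr23 hr34 ht2 ht4 ht6 hp1 hR0 hP1x hP1y hhor
  -- the end columns of the seven body runs and of the final run
  have hb1 := (hrun1 p₂ (Nat.succ_le_of_lt h12) le_rfl).1
  have hb2 := (hrun2 r₁ (Nat.succ_le_of_lt ht2) le_rfl).1
  have hb3 := (hrun3 r₂ (Nat.succ_le_of_lt hr12) le_rfl).1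
  have hb4 := (hrun4 p₃ (Nat.succ_le_of_lt ht4) le_rfl).1
  have hb5 := (hrun5 p₄ (Nat.succ_le_of_lt h34) le_rfl).1
  have hb6 := (hrun6 r₃ (Nat.succ_le_of_lt ht6) le_rfl).1
  have hb7 := (hrun7 r₄ (Nat.succ_le_of_lt hr34) le_rfl).1
  have hM := (hR8 m (Nat.succ_le_of_lt hr4m) le_rfl).1
  -- WALL: the resurfacing column lies right of the initial run; so do the two ends of the middle wall run
  have hwall : (p₁ : ℤ) + 1 ≤ ω r₄ 0 :=
    resurface_right_of_initial_run hinj (fun i h1 h2 => (hb' i h1 h2).1)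
        (by clear * - h12 ht2 hr12 ht4 h34 ht6 hr34; omega) hr4m hR0
      hR8
  have hm3 := wall_point_right_of_initial_run (t := r₂ + 1) hinj (fun i h1 h2 => (hb' i h1 h2).1)
    (by clear * - h12 ht2 hr12; omega) (by clear * - ht4 h34 ht6 hr34 hr4m; omega) hR0
    (hrun4 (r₂ + 1) le_rfl (by clear * - ht4; omega)).2
  have hm3' := (hrun4 (r₂ + 1) le_rfl (by clear * - ht4; omega)).1
  have hm4 := wall_point_right_of_initial_run (t := p₃) hinj (fun i h1 h2 => (hb' i h1 h2).1)
    (by clear * - h12 ht2 hr12 ht4; omega) (by clear * - h34 ht6 hr34 hr4m; omega) hR0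
    (hrun4 p₃ (by clear * - ht4; omega) le_rfl).2
  -- ROWS: the runs sharing a row are separated (self-avoidance)
  have hrow13 := row_runs_apart (a := (p₁ : ℤ)) (c := ω r₁ 0) he₁ he₃ (Nat.succ_le_of_lt h12)
    (Nat.succ_le_of_lt hr12) (fun i h1 h2 => (hrun1 i h1 h2).1) (fun j h1 h2 => (hrun3 j h1 h2).1)
    (fun i j hi1 hi2 hj1 hj2 hx => by
      have := hinj (hmem i (by clear * - hi2 ht2 hr12 ht4 h34 ht6 hr34 hr4m; omega))
          (hmem j (by clear * - hj2 hr12 ht4 h34 ht6 hr34 hr4m; omega))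
        (site_ext_d4j hx (by rw [(hrun1 i hi1 hi2).2, (hrun3 j hj1 hj2).2]))
      clear * - this hi2 hj1 ht2
      omega)
  have hrow15 := row_runs_apart (a := (p₁ : ℤ)) (c := ω p₃ 0) he₁ he₅ (Nat.succ_le_of_lt h12)
    (Nat.succ_le_of_lt h34) (fun i h1 h2 => (hrun1 i h1 h2).1) (fun j h1 h2 => (hrun5 j h1 h2).1)
    (fun i j hi1 hi2 hj1 hj2 hx => by
      have := hinj (hmem i (by clear * - hi2 ht2 hr12 ht4 h34 ht6 hr34 hr4m; omega))
          (hmem j (by clear * - hj2 h34 ht6 hr34 hr4m; omega))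
        (site_ext_d4j hx (by rw [(hrun1 i hi1 hi2).2, (hrun5 j hj1 hj2).2]))
      clear * - this hi2 hj1 ht2 hr12 ht4
      omega)
  have hrow17 := row_runs_apart (a := (p₁ : ℤ)) (c := ω r₃ 0) he₁ he₇ (Nat.succ_le_of_lt h12)
    (Nat.succ_le_of_lt hr34) (fun i h1 h2 => (hrun1 i h1 h2).1) (fun j h1 h2 => (hrun7 j h1 h2).1)
    (fun i j hi1 hi2 hj1 hj2 hx => by
      have := hinj (hmem i (by clear * - hi2 ht2 hr12 ht4 h34 ht6 hr34 hr4m; omega))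
          (hmem j (by clear * - hj2 hr34 hr4m; omega))
        (site_ext_d4j hx (by rw [(hrun1 i hi1 hi2).2, (hrun7 j hj1 hj2).2]))
      clear * - this hi2 hj1 ht2 hr12 ht4 h34 ht6
      omega)
  have hrow35 := row_runs_apart (a := ω r₁ 0) (c := ω p₃ 0) he₃ he₅ (Nat.succ_le_of_lt hr12)
    (Nat.succ_le_of_lt h34) (fun i h1 h2 => (hrun3 i h1 h2).1) (fun j h1 h2 => (hrun5 j h1 h2).1)
    (fun i j hi1 hi2 hj1 hj2 hx => by
      have := hinj (hmem i (by clear * - hi2 ht4 h34 ht6 hr34 hr4m; omega))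
          (hmem j (by clear * - hj2 h34 ht6 hr34 hr4m; omega))
        (site_ext_d4j hx (by rw [(hrun3 i hi1 hi2).2, (hrun5 j hj1 hj2).2]))
      clear * - this hi2 hj1 ht4
      omega)
  have hrow37 := row_runs_apart (a := ω r₁ 0) (c := ω r₃ 0) he₃ he₇ (Nat.succ_le_of_lt hr12)
    (Nat.succ_le_of_lt hr34) (fun i h1 h2 => (hrun3 i h1 h2).1) (fun j h1 h2 => (hrun7 j h1 h2).1)
    (fun i j hi1 hi2 hj1 hj2 hx => by
      have := hinj (hmem i (by clear * - hi2 ht4 h34 ht6 hr34 hr4m; omega))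
          (hmem j (by clear * - hj2 hr34 hr4m; omega))
        (site_ext_d4j hx (by rw [(hrun3 i hi1 hi2).2, (hrun7 j hj1 hj2).2]))
      clear * - this hi2 hj1 ht4 h34 ht6
      omega)
  have hrow57 := row_runs_apart (a := ω p₃ 0) (c := ω r₃ 0) he₅ he₇ (Nat.succ_le_of_lt h34)
    (Nat.succ_le_of_lt hr34) (fun i h1 h2 => (hrun5 i h1 h2).1) (fun j h1 h2 => (hrun7 j h1 h2).1)
    (fun i j hi1 hi2 hj1 hj2 hx => by
      have := hinj (hmem i (by clear * - hi2 ht6 hr34 hr4m; omega)) (hmem j (by clear * - hj2 hr34 hr4m; omega))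
        (site_ext_d4j hx (by rw [(hrun5 i hi1 hi2).2, (hrun7 j hj1 hj2).2]))
      clear * - this hi2 hj1 ht6
      omega)
  have hrow26 := row_runs_apart (a := ω p₂ 0) (c := ω p₄ 0) he₂ he₆ (Nat.succ_le_of_lt ht2)
    (Nat.succ_le_of_lt ht6) (fun i h1 h2 => (hrun2 i h1 h2).1) (fun j h1 h2 => (hrun6 j h1 h2).1)
    (fun i j hi1 hi2 hj1 hj2 hx => by
      have := hinj (hmem i (by clear * - hi2 hr12 ht4 h34 ht6 hr34 hr4m; omega))
          (hmem j (by clear * - hj2 ht6 hr34 hr4m; omega))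
        (site_ext_d4j hx (by rw [(hrun2 i hi1 hi2).2, (hrun6 j hj1 hj2).2]))
      clear * - this hi2 hj1 hr12 ht4 h34
      omega)
  have hrow48 := row_runs_apart (a := ω r₂ 0) (c := ω r₄ 0) (eB := 1) he₄ (Or.inl rfl) (Nat.succ_le_of_lt ht4)
    (Nat.succ_le_of_lt hr4m) (fun i h1 h2 => (hrun4 i h1 h2).1)
    (fun j h1 h2 => by rw [one_mul]; exact (hR8 j h1 h2).1)
    (fun i j hi1 hi2 hj1 hj2 hx => by
      have := hinj (hmem i (by clear * - hi2 h34 ht6 hr34 hr4m; omega)) (hmem j hj2)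
        (site_ext_d4j hx (by rw [(hrun4 i hi1 hi2).2, (hR8 j hj1 hj2).2]))
      clear * - this hi2 hj1 h34 ht6 hr34
      omega)
  -- SIGNS, sign-free
  have E1 : ω p₂ 0 = p₁ + ((p₂ - p₁ - 1 : ℕ) : ℤ) ∨ ω p₂ 0 + ((p₂ - p₁ - 1 : ℕ) : ℤ) = p₁ := by
    clear * - he₁ hb1 h12; rcases he₁ with rfl | rfl <;> omega
  have E2 : ω r₁ 0 = ω p₂ 0 + ((r₁ - p₂ - 1 : ℕ) : ℤ) ∨ ω r₁ 0 + ((r₁ - p₂ - 1 : ℕ) : ℤ) = ω p₂ 0 := by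
    clear * - he₂ hb2 ht2; rcases he₂ with rfl | rfl <;> omega
  have E3 : ω r₂ 0 = ω r₁ 0 + ((r₂ - r₁ - 1 : ℕ) : ℤ) ∨ ω r₂ 0 + ((r₂ - r₁ - 1 : ℕ) : ℤ) = ω r₁ 0 := by
    clear * - he₃ hb3 hr12; rcases he₃ with rfl | rfl <;> omega
  have E4 : ω p₃ 0 = ω r₂ 0 + ((p₃ - r₂ - 1 : ℕ) : ℤ) ∨ ω p₃ 0 + ((p₃ - r₂ - 1 : ℕ) : ℤ) = ω r₂ 0 := by
    clear * - he₄ hb4 ht4; rcases he₄ with rfl | rfl <;> omega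
  have E5 : ω p₄ 0 = ω p₃ 0 + ((p₄ - p₃ - 1 : ℕ) : ℤ) ∨ ω p₄ 0 + ((p₄ - p₃ - 1 : ℕ) : ℤ) = ω p₃ 0 := by
    clear * - he₅ hb5 h34; rcases he₅ with rfl | rfl <;> omega
  have E6 : ω r₃ 0 = ω p₄ 0 + ((r₃ - p₄ - 1 : ℕ) : ℤ) ∨ ω r₃ 0 + ((r₃ - p₄ - 1 : ℕ) : ℤ) = ω p₄ 0 := by
    clear * - he₆ hb6 ht6; rcases he₆ with rfl | rfl <;> omega
  have E7 : ω r₄ 0 = ω r₃ 0 + ((r₄ - r₃ - 1 : ℕ) : ℤ) ∨ ω r₄ 0 + ((r₄ - r₃ - 1 : ℕ) : ℤ) = ω r₃ 0 := by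
    clear * - he₇ hb7 hr34; rcases he₇ with rfl | rfl <;> omega
  -- IRR: the low and the high shield
  have hlo : p₁ ≤ 2 ∨ ω p₂ 0 ≤ 2 ∨ ω r₁ 0 ≤ 2 ∨ ω r₂ 0 ≤ 2 ∨ ω p₃ 0 ≤ 2 ∨ ω p₄ 0 ≤ 2 ∨ ω r₃ 0 ≤ 2 := by
    rcases Nat.lt_or_ge p₁ 3 with h | h
    · exact Or.inl (by clear * - h; omega)
    · exact Or.inr (four_down_shield_low hbr hirr hR0 he₁ he₂ he₃ he₄ he₅ he₆ he₇
        (fun i h1 h2 => (hrun1 i h1 h2).1) (fun i h1 h2 => (hrun2 i h1 h2).1) (fun i h1 h2 => (hrun3 i h1 h2).1)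
        (fun i h1 h2 => (hrun4 i h1 h2).1) (fun i h1 h2 => (hrun5 i h1 h2).1) (fun i h1 h2 => (hrun6 i h1 h2).1)
        (fun i h1 h2 => (hrun7 i h1 h2).1) hR8 h h12 ht2 hr12 ht4 h34 ht6 hr34 hr4m hwall)
  have hhi : m - r₄ - 1 ≤ 2 ∨ ω m 0 ≤ ω p₂ 0 + 1 ∨ ω m 0 ≤ ω r₁ 0 + 1 ∨ ω m 0 ≤ ω r₂ 0 + 1 ∨
      ω m 0 ≤ ω p₃ 0 + 1 ∨ ω m 0 ≤ ω p₄ 0 + 1 ∨ ω m 0 ≤ ω r₃ 0 + 1 := by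
    rcases Nat.lt_or_ge (m - r₄ - 1) 3 with h | h
    · exact Or.inl (by clear * - h; omega)
    · exact Or.inr (four_down_shield_high hbr hirr hR0 he₁ he₂ he₃ he₄ he₅ he₆ he₇
        (fun i h1 h2 => (hrun1 i h1 h2).1) (fun i h1 h2 => (hrun2 i h1 h2).1) (fun i h1 h2 => (hrun3 i h1 h2).1)
        (fun i h1 h2 => (hrun4 i h1 h2).1) (fun i h1 h2 => (hrun5 i h1 h2).1) (fun i h1 h2 => (hrun6 i h1 h2).1)
        (fun i h1 h2 => (hrun7 i h1 h2).1) hR8 (by clear * - h hr4m; omega) (by clear * - hm; omega) h12 ht2 hr12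
        ht4 h34 ht6 hr34 hwall)
  -- IRR: the middle shield at an even-time wall point of run 4 (time parity = column parity on the wall row)
  have hmid : ∀ t, r₂ + 1 ≤ t → t ≤ p₃ → (ω t 0 + ω t 1) % 2 = 0 →
      ω t 0 < p₁ ∨ ω t 0 < ω p₂ 0 ∨ ω t 0 < ω r₁ 0 ∨ ω t 0 < ω r₂ 0 ∨ ω p₃ 0 ≤ ω t 0 ∨ ω p₄ 0 ≤ ω t 0 ∨
        ω r₃ 0 ≤ ω t 0 ∨ ω r₄ 0 ≤ ω t 0 := fun t hu1 hu2 hpar =>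
    four_down_shield_mid hbr hirr hR0 he₁ he₂ he₃ he₄ he₅ he₆ he₇
      (fun i h1 h2 => (hrun1 i h1 h2).1) (fun i h1 h2 => (hrun2 i h1 h2).1) (fun i h1 h2 => (hrun3 i h1 h2).1)
      (fun i h1 h2 => (hrun4 i h1 h2).1) (fun i h1 h2 => (hrun5 i h1 h2).1) (fun i h1 h2 => (hrun6 i h1 h2).1)
      (fun i h1 h2 => (hrun7 i h1 h2).1) hR8 h12 ht2 hr12 ht4 h34 ht6 hr34 hr4m hu1 hu2
      (by
        have := parity_apply hs (i := t) (by clear * - hu2 h34 ht6 hr34 hr4m; omega)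
        clear * - this hpar
        omega)
      (hrun4 t hu1 hu2).2
  -- XRNG: the bridge range
  have hX1 := (hb' p₂ (by clear * - hp1 h12; omega) (by clear * - ht2 hr12 ht4 h34 ht6 hr34 hr4m; omega)).2
  have hX2 := (hb' r₁ (by clear * - hp1 h12 ht2; omega) (by clear * - hr12 ht4 h34 ht6 hr34 hr4m; omega)).2
  have hX3 := (hb' r₂ (by clear * - hp1 h12 ht2 hr12; omega) (by clear * - ht4 h34 ht6 hr34 hr4m; omega)).2
  have hX4 := (hb' p₃ (by clear * - hp1 h12 ht2 hr12 ht4; omega) (by clear * - h34 ht6 hr34 hr4m; omega)).2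
  have hX5 := (hb' p₄ (by clear * - hp1 h12 ht2 hr12 ht4 h34; omega) (by clear * - ht6 hr34 hr4m; omega)).2
  have hX6 := (hb' r₃ (by clear * - hp1 h12 ht2 hr12 ht4 h34 ht6; omega) (by clear * - hr34 hr4m; omega)).2
  -- integer columns, then the fields of the system one by one (each `omega` sees few disjunctions)
  obtain ⟨c1, hC1⟩ := Int.eq_ofNat_of_zero_le hx2.le
  obtain ⟨c2, hC2⟩ := Int.eq_ofNat_of_zero_le hx3.le
  obtain ⟨c3, hC3⟩ := Int.eq_ofNat_of_zero_le hx4.le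
  obtain ⟨c4, hC4⟩ := Int.eq_ofNat_of_zero_le hx5.le
  obtain ⟨c5, hC5⟩ := Int.eq_ofNat_of_zero_le hx6.le
  obtain ⟨c6, hC6⟩ := Int.eq_ofNat_of_zero_le hx7.le
  obtain ⟨c7, hC7⟩ := Int.eq_ofNat_of_zero_le (show (0 : ℤ) ≤ ω r₄ 0 by clear * - hwall; omega)
  have mid0 : p₁ + 1 ≤ c3 ∧ p₁ + 1 ≤ c4 := by
    clear * - hm3 hm3' hm4 hC3 hC4 he₄; rcases he₄ with rfl | rfl <;> constructor <;> omega
  have irrmid : ∀ x : ℕ, x % 2 = 0 → c3 + 1 ≤ x → x + 1 ≤ c4 →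
      x < p₁ ∨ x < c1 ∨ x < c2 ∨ x < c3 ∨ c4 ≤ x ∨ c5 ≤ x ∨ c6 ≤ x ∨ c7 ≤ x := by
    intro x hx hx1 hx2
    -- run 4 is rightward here and passes through `(x, 0)` at the time `r₂ + 2 + d`, `x = c₃ + 1 + d`
    obtain ⟨d, rfl⟩ : ∃ d, x = c3 + 1 + d := ⟨x - c3 - 1, by clear * - hx1; omega⟩
    have hE4 : e₄ = 1 := by
      clear * - he₄ hb4 hC3 hC4 hx1 hx2 ht4
      rcases he₄ with h | h
      · exact h
      · exfalso; rw [h] at hb4; omega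
    subst hE4
    have ht : r₂ + 2 + d ≤ p₃ := by clear * - hb4 hC3 hC4 hx2 ht4; omega
    have hcol := (hrun4 (r₂ + 2 + d) (by clear * - hx1; omega) ht).1
    have KEY := hmid (r₂ + 2 + d) (by clear * - hx1; omega) ht (by
      rw [hcol, (hrun4 (r₂ + 2 + d) (by clear * - hx1; omega) ht).2]; clear * - hx hC3; omega)
    rw [hcol] at KEY
    clear * - KEY hC1 hC2 hC3 hC4 hC5 hC6 hC7
    omega
  clear hrun1 hrun2 hrun3 hrun4 hrun5 hrun6 hrun7 hR8 hhor hmD hR0 hb' hbr hirr he₁ he₂ he₃ he₄ he₅ he₆ he₇ hppar1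
    hP1x hP1y hmem hinj hbw hb1 hb2 hb3 hb4 hb5 hb6 hb7 hpw hw ha hh hs hhp h0 hX0 hn1 hm3 hm3' hm4 hmid
  refine ⟨c1, c2, c3, c4, c5, c6, c7, hC1.symm, hC2.symm, hC3.symm, hC4.symm, hC5.symm, hC6.symm, hC7.symm, hs_eq, ?_⟩
  have row13 : (p₁ < c2 ∧ p₁ < c3 ∧ c1 < c2 ∧ c1 < c3) ∨ (c2 < p₁ ∧ c3 < p₁ ∧ c2 < c1 ∧ c3 < c1) := by
    clear * - hrow13 hC1 hC2 hC3; omega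
  have row15 : (p₁ < c4 ∧ p₁ < c5 ∧ c1 < c4 ∧ c1 < c5) ∨ (c4 < p₁ ∧ c5 < p₁ ∧ c4 < c1 ∧ c5 < c1) := by
    clear * - hrow15 hC1 hC4 hC5; omega
  have row17 : (p₁ < c6 ∧ p₁ < c7 ∧ c1 < c6 ∧ c1 < c7) ∨ (c6 < p₁ ∧ c7 < p₁ ∧ c6 < c1 ∧ c7 < c1) := by
    clear * - hrow17 hC1 hC6 hC7; omega
  have row35 : (c2 < c4 ∧ c2 < c5 ∧ c3 < c4 ∧ c3 < c5) ∨ (c4 < c2 ∧ c5 < c2 ∧ c4 < c3 ∧ c5 < c3) := by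
    clear * - hrow35 hC2 hC3 hC4 hC5; omega
  have row37 : (c2 < c6 ∧ c2 < c7 ∧ c3 < c6 ∧ c3 < c7) ∨ (c6 < c2 ∧ c7 < c2 ∧ c6 < c3 ∧ c7 < c3) := by
    clear * - hrow37 hC2 hC3 hC6 hC7; omega
  have row57 : (c4 < c6 ∧ c4 < c7 ∧ c5 < c6 ∧ c5 < c7) ∨ (c6 < c4 ∧ c7 < c4 ∧ c6 < c5 ∧ c7 < c5) := by
    clear * - hrow57 hC4 hC5 hC6 hC7; omega
  have row26 : (c1 < c5 ∧ c1 < c6 ∧ c2 < c5 ∧ c2 < c6) ∨ (c5 < c1 ∧ c6 < c1 ∧ c5 < c2 ∧ c6 < c2) := by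
    clear * - hrow26 hC1 hC2 hC5 hC6; omega
  have row48 : (c3 < c7 ∧ c3 < c7 + (m - r₄ - 1) ∧ c4 < c7 ∧ c4 < c7 + (m - r₄ - 1)) ∨
      (c7 < c3 ∧ c7 + (m - r₄ - 1) < c3 ∧ c7 < c4 ∧ c7 + (m - r₄ - 1) < c4) := by
    clear * - hrow48 hC3 hC4 hC7 hM hr4m; omega
  clear hrow13 hrow15 hrow17 hrow35 hrow37 hrow57 hrow26 hrow48
  have lo : p₁ ≤ 2 ∨ c1 ≤ 2 ∨ c2 ≤ 2 ∨ c3 ≤ 2 ∨ c4 ≤ 2 ∨ c5 ≤ 2 ∨ c6 ≤ 2 ∨ c7 ≤ 2 := by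
    clear * - hlo hC1 hC2 hC3 hC4 hC5 hC6; omega
  have hi : m - r₄ - 1 ≤ 2 ∨ c7 + (m - r₄ - 1) ≤ c1 + 1 ∨ c7 + (m - r₄ - 1) ≤ c2 + 1 ∨
      c7 + (m - r₄ - 1) ≤ c3 + 1 ∨ c7 + (m - r₄ - 1) ≤ c4 + 1 ∨ c7 + (m - r₄ - 1) ≤ c5 + 1 ∨
      c7 + (m - r₄ - 1) ≤ c6 + 1 ∨ c7 + (m - r₄ - 1) ≤ p₁ + 1 := by
    clear * - hhi hM hC1 hC2 hC3 hC4 hC5 hC6 hC7 hr4m; omega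
  clear hlo hhi
  have e1 : c1 = p₁ + (p₂ - p₁ - 1) ∨ c1 + (p₂ - p₁ - 1) = p₁ := by
    clear * - E1 hC1 h12; omega
  have e2 : c2 = c1 + (r₁ - p₂ - 1) ∨ c2 + (r₁ - p₂ - 1) = c1 := by
    clear * - E2 hC1 hC2 ht2; omega
  have e3 : c3 = c2 + (r₂ - r₁ - 1) ∨ c3 + (r₂ - r₁ - 1) = c2 := by
    clear * - E3 hC2 hC3 hr12; omega
  have e4 : c4 = c3 + (p₃ - r₂ - 1) ∨ c4 + (p₃ - r₂ - 1) = c3 := by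
    clear * - E4 hC3 hC4 ht4; omega
  have e5 : c5 = c4 + (p₄ - p₃ - 1) ∨ c5 + (p₄ - p₃ - 1) = c4 := by
    clear * - E5 hC4 hC5 h34; omega
  have e6 : c6 = c5 + (r₃ - p₄ - 1) ∨ c6 + (r₃ - p₄ - 1) = c5 := by
    clear * - E6 hC5 hC6 ht6; omega
  have e7 : c7 = c6 + (r₄ - r₃ - 1) ∨ c7 + (r₄ - r₃ - 1) = c6 := by
    clear * - E7 hC6 hC7 hr34; omega
  clear E1 E2 E3 E4 E5 E6 E7
  have hp1' : (p₂ - p₁ - 1) % 2 = 1 := by clear * - e1 hpodd hq2 hC1 h12; omega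
  have hp2' : (r₁ - p₂ - 1) % 2 = 0 := by clear * - e2 hq2 hq3 hC1 hC2 ht2; omega
  have hp3' : (r₂ - r₁ - 1) % 2 = 1 := by clear * - e3 hq3 hq4 hC2 hC3 hr12; omega
  have hp4' : (p₃ - r₂ - 1) % 2 = 0 := by clear * - e4 hq4 hq5 hC3 hC4 ht4; omega
  have hp5' : (p₄ - p₃ - 1) % 2 = 1 := by clear * - e5 hq5 hq6 hC4 hC5 h34; omega
  have hp6' : (r₃ - p₄ - 1) % 2 = 0 := by clear * - e6 hq6 hq7 hC5 hC6 ht6; omega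
  have hp7' : (r₄ - r₃ - 1) % 2 = 1 := by clear * - e7 hq7 hq8 hC6 hC7 hr34; omega
  have hh1 : 1 ≤ p₂ - p₁ - 1 := by clear * - hg1 e1 hpodd hq2 hC1 h12; omega
  have hh2 : 1 ≤ r₁ - p₂ - 1 := by clear * - hg2 e2 hq2 hq3 hC1 hC2 ht2; omega
  have hh3 : 1 ≤ r₂ - r₁ - 1 := by clear * - e3 hq3 hq4 hC2 hC3 hr12; omega
  have hh4 : 1 ≤ p₃ - r₂ - 1 := by clear * - hg4 e4 hq4 hq5 hC3 hC4 ht4; omega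
  have hh5 : 1 ≤ p₄ - p₃ - 1 := by clear * - hg5 e5 hq5 hq6 hC4 hC5 h34; omega
  have hh6 : 1 ≤ r₃ - p₄ - 1 := by clear * - hg6 e6 hq6 hq7 hC5 hC6 ht6; omega
  have hh7 : 1 ≤ r₄ - r₃ - 1 := by clear * - e7 hq7 hq8 hC6 hC7 hr34; omega
  have hX1' : c1 ≤ c7 + (m - r₄ - 1) := by clear * - hX1 hM hC1 hC7 hr4m; omega
  have hX2' : c2 ≤ c7 + (m - r₄ - 1) := by clear * - hX2 hM hC2 hC7 hr4m; omega
  have hX3' : c3 ≤ c7 + (m - r₄ - 1) := by clear * - hX3 hM hC3 hC7 hr4m; omega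
  have hX4' : c4 ≤ c7 + (m - r₄ - 1) := by clear * - hX4 hM hC4 hC7 hr4m; omega
  have hX5' : c5 ≤ c7 + (m - r₄ - 1) := by clear * - hX5 hM hC5 hC7 hr4m; omega
  have hX6' : c6 ≤ c7 + (m - r₄ - 1) := by clear * - hX6 hM hC6 hC7 hr4m; omega
  exact
    { hk := hk, hlen := by clear * - hm h12 ht2 hr12 ht4 h34 ht6 hr34 hr4m; omega,
      hvis := by clear * - hs_eq hr4m ht4; omega, hf := by clear * - hs_eq hpodd hp4' hm hr4m ht4; omega,
      hpp := hpodd, hp1 := hp1', hp2 := hp2', hp3 := hp3', hp4 := hp4', hp5 := hp5', hp6 := hp6', hp7 := hp7',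
      hh1 := hh1, hh2 := hh2, hh3 := hh3, hh4 := hh4, hh5 := hh5, hh6 := hh6, hh7 := hh7, e1 := e1, e2 := e2,
      e3 := e3, e4 := e4, e5 := e5, e6 := e6, e7 := e7, row13 := row13, row15 := row15, row17 := row17,
      row35 := row35, row37 := row37, row57 := row57, row26 := row26, mid0 := mid0, row48 := row48,
      wall := by clear * - hwall hC7; omega, x1 := by clear * - hx2 hC1; omega, x2 := by clear * - hx3 hC2; omega,
      x3 := by clear * - hx4 hC3; omega, x4 := by clear * - hx5 hC4; omega, x5 := by clear * - hx6 hC5; omega,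
      x6 := by clear * - hx7 hC6; omega, X1 := hX1', X2 := hX2', X3 := hX3', X4 := hX4', X5 := hX5', X6 := hX6',
      irrlo := lo, irrhi := hi, irrmid := irrmid }

/-- **Family B5 identified**: a walk whose initial wall run is `0 … p`, whose seven body runs have the velocities of
family B5 (`L R R R L R R` on the rows `−1, −2, −1, 0, −1, −2, −1`) and whose vertical steps fall at the step times
of the table walk `s4j k a` coincides with it up to time `6k + 4` (four-down analogue of `ddduuu4_table_a` of
`…SlackFourThreeDownLaw`). [cite: MadrasSlade1993, §4.2, Definition 4.2.1 (p. 90)]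
[cite: EntingJensen2009, §7.4.2, Fig. 7.10] -/
theorem dduudduu4_table_j {k p t₂ t₃ t₄ t₅ t₆ t₇ t₈ a : ℕ}
    (hF1 : 1 ≤ a) (hF2 : a + 2 ≤ k) (hR0 : ∀ i, i ≤ p → ω i 0 = i ∧ ω i 1 = 0)
    (hrun1 : ∀ i, p + 1 ≤ i → i ≤ t₂ → ω i 0 = p + (-1) * ((i - (p + 1) : ℕ) : ℤ) ∧ ω i 1 = -1)
    (hrun2 : ∀ i, t₂ + 1 ≤ i → i ≤ t₃ → ω i 0 = ω t₂ 0 + 1 * ((i - (t₂ + 1) : ℕ) : ℤ) ∧ ω i 1 = -2)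
    (hrun3 : ∀ i, t₃ + 1 ≤ i → i ≤ t₄ → ω i 0 = ω t₃ 0 + 1 * ((i - (t₃ + 1) : ℕ) : ℤ) ∧ ω i 1 = -1)
    (hrun4 : ∀ i, t₄ + 1 ≤ i → i ≤ t₅ → ω i 0 = ω t₄ 0 + 1 * ((i - (t₄ + 1) : ℕ) : ℤ) ∧ ω i 1 = 0)
    (hrun5 : ∀ i, t₅ + 1 ≤ i → i ≤ t₆ → ω i 0 = ω t₅ 0 + (-1) * ((i - (t₅ + 1) : ℕ) : ℤ) ∧ ω i 1 = -1)
    (hrun6 : ∀ i, t₆ + 1 ≤ i → i ≤ t₇ → ω i 0 = ω t₆ 0 + 1 * ((i - (t₆ + 1) : ℕ) : ℤ) ∧ ω i 1 = -2)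
    (hrun7 : ∀ i, t₇ + 1 ≤ i → i ≤ t₈ → ω i 0 = ω t₇ 0 + 1 * ((i - (t₇ + 1) : ℕ) : ℤ) ∧ ω i 1 = -1)
    (hR8 : ∀ j, t₈ + 1 ≤ j → j ≤ 6 * k + 4 → ω j 0 = ω t₈ 0 + ((j - (t₈ + 1) : ℕ) : ℤ) ∧ ω j 1 = 0)
    (hpe : p = 2 * a + 1) (ht2e : t₂ = 4 * a + 1) (ht3e : t₃ = 6 * a + 2) (ht4e : t₄ = 6 * a + 4)
    (ht5e : t₅ = 2 * k + 4 * a + 3) (ht6e : t₆ = 4 * k + 2 * a + 1) (ht7e : t₇ = 6 * k) (ht8e : t₈ = 6 * k + 2) :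
    ∀ t, t ≤ 6 * k + 4 → ω t 0 = s4jX k a t ∧ ω t 1 = s4jY k a t := by
  have hc1 := (hrun1 t₂ (by omega) le_rfl).1
  have hc2 := (hrun2 t₃ (by omega) le_rfl).1
  have hc3 := (hrun3 t₄ (by omega) le_rfl).1
  have hc4 := (hrun4 t₅ (by omega) le_rfl).1
  have hc5 := (hrun5 t₆ (by omega) le_rfl).1
  have hc6 := (hrun6 t₇ (by omega) le_rfl).1
  have hc7 := (hrun7 t₈ (by omega) le_rfl).1
  intro t ht
  simp only [s4jX, s4jY]
  rcases Nat.lt_or_ge t (p + 1) with h1 | h1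
  · obtain ⟨hx, hy⟩ := hR0 t (by omega)
    clear hR0 hrun1 hrun2 hrun3 hrun4 hrun5 hrun6 hrun7 hR8
    have hk1 : t ≤ 2 * a + 1 := by omega
    rw [hx, hy, if_pos hk1, if_pos hk1]
    constructor <;> omega
  rcases Nat.lt_or_ge t (t₂ + 1) with h2 | h2
  · obtain ⟨hx, hy⟩ := hrun1 t h1 (by omega)
    clear hR0 hrun1 hrun2 hrun3 hrun4 hrun5 hrun6 hrun7 hR8
    have hk1 : ¬ (t ≤ 2 * a + 1) := by omega
    have hk2 : t ≤ 4 * a + 1 := by omega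
    rw [hx, hy, if_neg hk1, if_neg hk1, if_pos hk2, if_pos hk2]
    constructor <;> omega
  rcases Nat.lt_or_ge t (t₃ + 1) with h3 | h3
  · obtain ⟨hx, hy⟩ := hrun2 t h2 (by omega)
    clear hR0 hrun1 hrun2 hrun3 hrun4 hrun5 hrun6 hrun7 hR8
    have hk1 : ¬ (t ≤ 2 * a + 1) := by omega
    have hk2 : ¬ (t ≤ 4 * a + 1) := by omega
    have hk3 : t ≤ 6 * a + 2 := by omega
    rw [hx, hy, if_neg hk1, if_neg hk1, if_neg hk2, if_neg hk2, if_pos hk3, if_pos hk3]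
    constructor <;> omega
  rcases Nat.lt_or_ge t (t₄ + 1) with h4 | h4
  · obtain ⟨hx, hy⟩ := hrun3 t h3 (by omega)
    clear hR0 hrun1 hrun2 hrun3 hrun4 hrun5 hrun6 hrun7 hR8
    have hk1 : ¬ (t ≤ 2 * a + 1) := by omega
    have hk2 : ¬ (t ≤ 4 * a + 1) := by omega
    have hk3 : ¬ (t ≤ 6 * a + 2) := by omega
    have hk4 : t ≤ 6 * a + 4 := by omega
    rw [hx, hy, if_neg hk1, if_neg hk1, if_neg hk2, if_neg hk2, if_neg hk3, if_neg hk3, if_pos hk4, if_pos hk4]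
    constructor <;> omega
  rcases Nat.lt_or_ge t (t₅ + 1) with h5 | h5
  · obtain ⟨hx, hy⟩ := hrun4 t h4 (by omega)
    clear hR0 hrun1 hrun2 hrun3 hrun4 hrun5 hrun6 hrun7 hR8
    have hk1 : ¬ (t ≤ 2 * a + 1) := by omega
    have hk2 : ¬ (t ≤ 4 * a + 1) := by omega
    have hk3 : ¬ (t ≤ 6 * a + 2) := by omega
    have hk4 : ¬ (t ≤ 6 * a + 4) := by omega
    have hk5 : t ≤ 2 * k + 4 * a + 3 := by omega
    rw [hx, hy, if_neg hk1, if_neg hk1, if_neg hk2, if_neg hk2, if_neg hk3, if_neg hk3, if_neg hk4, if_neg hk4,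
        if_pos hk5, if_pos hk5]
    constructor <;> omega
  rcases Nat.lt_or_ge t (t₆ + 1) with h6 | h6
  · obtain ⟨hx, hy⟩ := hrun5 t h5 (by omega)
    clear hR0 hrun1 hrun2 hrun3 hrun4 hrun5 hrun6 hrun7 hR8
    have hk1 : ¬ (t ≤ 2 * a + 1) := by omega
    have hk2 : ¬ (t ≤ 4 * a + 1) := by omega
    have hk3 : ¬ (t ≤ 6 * a + 2) := by omega
    have hk4 : ¬ (t ≤ 6 * a + 4) := by omega
    have hk5 : ¬ (t ≤ 2 * k + 4 * a + 3) := by omega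
    have hk6 : t ≤ 4 * k + 2 * a + 1 := by omega
    rw [hx, hy, if_neg hk1, if_neg hk1, if_neg hk2, if_neg hk2, if_neg hk3, if_neg hk3, if_neg hk4, if_neg hk4,
        if_neg hk5, if_neg hk5, if_pos hk6, if_pos hk6]
    constructor <;> omega
  rcases Nat.lt_or_ge t (t₇ + 1) with h7 | h7
  · obtain ⟨hx, hy⟩ := hrun6 t h6 (by omega)
    clear hR0 hrun1 hrun2 hrun3 hrun4 hrun5 hrun6 hrun7 hR8
    have hk1 : ¬ (t ≤ 2 * a + 1) := by omega
    have hk2 : ¬ (t ≤ 4 * a + 1) := by omega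
    have hk3 : ¬ (t ≤ 6 * a + 2) := by omega
    have hk4 : ¬ (t ≤ 6 * a + 4) := by omega
    have hk5 : ¬ (t ≤ 2 * k + 4 * a + 3) := by omega
    have hk6 : ¬ (t ≤ 4 * k + 2 * a + 1) := by omega
    have hk7 : t ≤ 6 * k := by omega
    rw [hx, hy, if_neg hk1, if_neg hk1, if_neg hk2, if_neg hk2, if_neg hk3, if_neg hk3, if_neg hk4, if_neg hk4,
        if_neg hk5, if_neg hk5, if_neg hk6, if_neg hk6, if_pos hk7, if_pos hk7]
    constructor <;> omega
  rcases Nat.lt_or_ge t (t₈ + 1) with h8 | h8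
  · obtain ⟨hx, hy⟩ := hrun7 t h7 (by omega)
    clear hR0 hrun1 hrun2 hrun3 hrun4 hrun5 hrun6 hrun7 hR8
    have hk1 : ¬ (t ≤ 2 * a + 1) := by omega
    have hk2 : ¬ (t ≤ 4 * a + 1) := by omega
    have hk3 : ¬ (t ≤ 6 * a + 2) := by omega
    have hk4 : ¬ (t ≤ 6 * a + 4) := by omega
    have hk5 : ¬ (t ≤ 2 * k + 4 * a + 3) := by omega
    have hk6 : ¬ (t ≤ 4 * k + 2 * a + 1) := by omega
    have hk7 : ¬ (t ≤ 6 * k) := by omega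
    have hk8 : t ≤ 6 * k + 2 := by omega
    rw [hx, hy, if_neg hk1, if_neg hk1, if_neg hk2, if_neg hk2, if_neg hk3, if_neg hk3, if_neg hk4, if_neg hk4,
        if_neg hk5, if_neg hk5, if_neg hk6, if_neg hk6, if_neg hk7, if_neg hk7, if_pos hk8, if_pos hk8]
    constructor <;> omega
  obtain ⟨hx, hy⟩ := hR8 t h8 ht
  clear hR0 hrun1 hrun2 hrun3 hrun4 hrun5 hrun6 hrun7 hR8
  have hk1 : ¬ (t ≤ 2 * a + 1) := by omega
  have hk2 : ¬ (t ≤ 4 * a + 1) := by omega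
  have hk3 : ¬ (t ≤ 6 * a + 2) := by omega
  have hk4 : ¬ (t ≤ 6 * a + 4) := by omega
  have hk5 : ¬ (t ≤ 2 * k + 4 * a + 3) := by omega
  have hk6 : ¬ (t ≤ 4 * k + 2 * a + 1) := by omega
  have hk7 : ¬ (t ≤ 6 * k) := by omega
  have hk8 : ¬ (t ≤ 6 * k + 2) := by omega
  rw [hx, hy, if_neg hk1, if_neg hk1, if_neg hk2, if_neg hk2, if_neg hk3, if_neg hk3, if_neg hk4, if_neg hk4,
      if_neg hk5, if_neg hk5, if_neg hk6, if_neg hk6, if_neg hk7, if_neg hk7, if_neg hk8, if_neg hk8]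
  constructor <;> omega

/-- **A `D D U U D D U U` block satisfying system B5 IS a table walk `s4j k a`, `1 ≤ a ≤ k − 2`.** The signs
`L R R R L R R` of the seven body runs are forced by the system against the run end columns; the parities of
`p, h₁ … h₇` give the half variables; the step times are then those of the table, so `dduudduu4_table_j` and
`eq_tab_walk_of_forall` identify the walk (membership in `ddddBlocks k` is then `s4j_mem_ddddBlocks` of
`…SlackFourFourDownIdentShallow`, not imported here). Inputs: the runs of `dduudduu4_runs`
(`…SlackFourFourDownRunsReturn`), the system `Dduudduu4Hyp` produced by `dduudduu4_hyp` and the table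
`dduudduu4_int_table` (`…SlackFourFourDownReturnHyp`) as `hF`.
[cite: MadrasSlade1993, §4.2, Definition 4.2.1 (p. 90), remark before (4.2.21) (p. 94)]
[cite: EntingJensen2009, §7.4.2, Fig. 7.10] -/
theorem dduudduu4_eq_s4j {k m p₁ p₂ p₃ p₄ r₁ r₂ r₃ r₄ c1 c2 c3 c4 c5 c6 c7 p f h1 h2 h3 h4 h5 h6 h7 : ℕ}
    {e₁ e₂ e₃ e₄ e₅ e₆ e₇ : ℤ}
    (hm : m = 6 * k + 4) (hs : ω ∈ saws m) (hR0 : ∀ i, i ≤ p₁ → ω i 0 = i ∧ ω i 1 = 0) (he₁ : e₁ = 1 ∨ e₁ = -1)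
    (he₂ : e₂ = 1 ∨ e₂ = -1) (he₃ : e₃ = 1 ∨ e₃ = -1) (he₄ : e₄ = 1 ∨ e₄ = -1) (he₅ : e₅ = 1 ∨ e₅ = -1)
    (he₆ : e₆ = 1 ∨ e₆ = -1) (he₇ : e₇ = 1 ∨ e₇ = -1)
    (hrun1 : ∀ i, p₁ + 1 ≤ i → i ≤ p₂ → ω i 0 = p₁ + e₁ * ((i - (p₁ + 1) : ℕ) : ℤ) ∧ ω i 1 = -1)
    (hrun2 : ∀ i, p₂ + 1 ≤ i → i ≤ r₁ → ω i 0 = ω p₂ 0 + e₂ * ((i - (p₂ + 1) : ℕ) : ℤ) ∧ ω i 1 = -2)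
    (hrun3 : ∀ i, r₁ + 1 ≤ i → i ≤ r₂ → ω i 0 = ω r₁ 0 + e₃ * ((i - (r₁ + 1) : ℕ) : ℤ) ∧ ω i 1 = -1)
    (hrun4 : ∀ i, r₂ + 1 ≤ i → i ≤ p₃ → ω i 0 = ω r₂ 0 + e₄ * ((i - (r₂ + 1) : ℕ) : ℤ) ∧ ω i 1 = 0)
    (hrun5 : ∀ i, p₃ + 1 ≤ i → i ≤ p₄ → ω i 0 = ω p₃ 0 + e₅ * ((i - (p₃ + 1) : ℕ) : ℤ) ∧ ω i 1 = -1)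
    (hrun6 : ∀ i, p₄ + 1 ≤ i → i ≤ r₃ → ω i 0 = ω p₄ 0 + e₆ * ((i - (p₄ + 1) : ℕ) : ℤ) ∧ ω i 1 = -2)
    (hrun7 : ∀ i, r₃ + 1 ≤ i → i ≤ r₄ → ω i 0 = ω r₃ 0 + e₇ * ((i - (r₃ + 1) : ℕ) : ℤ) ∧ ω i 1 = -1)
    (hR8 : ∀ j, r₄ + 1 ≤ j → j ≤ m → ω j 0 = ω r₄ 0 + ((j - (r₄ + 1) : ℕ) : ℤ) ∧ ω j 1 = 0) (hC1 : (c1 : ℤ) = ω p₂ 0)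
    (hC2 : (c2 : ℤ) = ω r₁ 0) (hC3 : (c3 : ℤ) = ω r₂ 0) (hC4 : (c4 : ℤ) = ω p₃ 0) (hC5 : (c5 : ℤ) = ω p₄ 0)
    (hC6 : (c6 : ℤ) = ω r₃ 0) (hC7 : (c7 : ℤ) = ω r₄ 0)
    (H : Dduudduu4Hyp k p f h1 h2 h3 h4 h5 h6 h7 c1 c2 c3 c4 c5 c6 c7) (hp : p = p₁) (hf : f = m - r₄ - 1)
    (hh1 : h1 = p₂ - p₁ - 1) (hh2 : h2 = r₁ - p₂ - 1) (hh3 : h3 = r₂ - r₁ - 1) (hh4 : h4 = p₃ - r₂ - 1)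
    (hh5 : h5 = p₄ - p₃ - 1) (hh6 : h6 = r₃ - p₄ - 1) (hh7 : h7 = r₄ - r₃ - 1)
    (hF :
      c1 + h1 = p ∧ c2 = c1 + h2 ∧ c3 = c2 + h3 ∧ c4 = c3 + h4 ∧ c5 + h5 = c4 ∧ c6 = c5 + h6 ∧ c7 = c6 + h7 ∧
      h1 + 2 = p ∧ h2 + 1 = p ∧ h3 = 1 ∧ p + h4 + 1 = 2 * k ∧ p + h5 + 2 = 2 * k ∧ p + h6 + 1 = 2 * k ∧ h7 = 1 ∧
      f = 1 ∧ 3 ≤ p ∧ p + 3 ≤ 2 * k) :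
    ∃ a : ℕ, 1 ≤ a ∧ a + 2 ≤ k ∧ ω = s4j k a := by
  subst hm
  have Hh1 := H.hh1; have Hh2 := H.hh2; have Hh3 := H.hh3; have Hh4 := H.hh4; have Hh5 := H.hh5; have Hh6 := H.hh6
  have Hh7 := H.hh7
  -- half variables from the parities
  obtain ⟨a0, ha0⟩ : ∃ a, p = 2 * a + 1 := ⟨p / 2, by have := H.hpp; clear * - this; omega⟩
  obtain ⟨d1, hd1⟩ : ∃ d, h1 = 2 * d + 1 := ⟨h1 / 2, by have := H.hp1; clear * - this; omega⟩
  obtain ⟨d2, hd2⟩ : ∃ d, h2 = 2 * d := ⟨h2 / 2, by have := H.hp2; clear * - this; omega⟩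
  obtain ⟨d3, hd3⟩ : ∃ d, h3 = 2 * d + 1 := ⟨h3 / 2, by have := H.hp3; clear * - this; omega⟩
  obtain ⟨d4, hd4⟩ : ∃ d, h4 = 2 * d := ⟨h4 / 2, by have := H.hp4; clear * - this; omega⟩
  obtain ⟨d5, hd5⟩ : ∃ d, h5 = 2 * d + 1 := ⟨h5 / 2, by have := H.hp5; clear * - this; omega⟩
  obtain ⟨d6, hd6⟩ : ∃ d, h6 = 2 * d := ⟨h6 / 2, by have := H.hp6; clear * - this; omega⟩
  obtain ⟨d7, hd7⟩ : ∃ d, h7 = 2 * d + 1 := ⟨h7 / 2, by have := H.hp7; clear * - this; omega⟩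
  -- additive forms of the run lengths (no truncated subtraction reaches `omega` below)
  have hf' : r₄ + f + 1 = 6 * k + 4 := by have := H.hf; clear * - this hf; omega
  have hh1' : p₁ + h1 + 1 = p₂ := by clear * - hh1 Hh1; omega
  have hh2' : p₂ + h2 + 1 = r₁ := by clear * - hh2 Hh2; omega
  have hh3' : r₁ + h3 + 1 = r₂ := by clear * - hh3 Hh3; omega
  have hh4' : r₂ + h4 + 1 = p₃ := by clear * - hh4 Hh4; omega
  have hh5' : p₃ + h5 + 1 = p₄ := by clear * - hh5 Hh5; omega
  have hh6' : p₄ + h6 + 1 = r₃ := by clear * - hh6 Hh6; omega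
  have hh7' : r₃ + h7 + 1 = r₄ := by clear * - hh7 Hh7; omega
  clear hf hh1 hh2 hh3 hh4 hh5 hh6 hh7
  -- end columns of the seven body runs
  have hb1 := (hrun1 p₂ (by clear * - hh1'; omega) le_rfl).1
  have hb2 := (hrun2 r₁ (by clear * - hh2'; omega) le_rfl).1
  have hb3 := (hrun3 r₂ (by clear * - hh3'; omega) le_rfl).1
  have hb4 := (hrun4 p₃ (by clear * - hh4'; omega) le_rfl).1
  have hb5 := (hrun5 p₄ (by clear * - hh5'; omega) le_rfl).1
  have hb6 := (hrun6 r₃ (by clear * - hh6'; omega) le_rfl).1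
  have hb7 := (hrun7 r₄ (by clear * - hh7'; omega) le_rfl).1
  -- the signs are forced by the system
  have E1 : e₁ = -1 := by
    clear * - he₁ hb1 hC1 hF hh1' Hh1 hp
    rcases he₁ with h | h
    · exfalso; rw [h] at hb1; omega
    · exact h
  subst E1
  have E2 : e₂ = 1 := by
    clear * - he₂ hb2 hC1 hC2 hF hh2' Hh2 hp
    rcases he₂ with h | h
    · exact h
    · exfalso; rw [h] at hb2; omega
  subst E2
  have E3 : e₃ = 1 := by
    clear * - he₃ hb3 hC2 hC3 hF hh3' Hh3 hp
    rcases he₃ with h | h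
    · exact h
    · exfalso; rw [h] at hb3; omega
  subst E3
  have E4 : e₄ = 1 := by
    clear * - he₄ hb4 hC3 hC4 hF hh4' Hh4 hp
    rcases he₄ with h | h
    · exact h
    · exfalso; rw [h] at hb4; omega
  subst E4
  have E5 : e₅ = -1 := by
    clear * - he₅ hb5 hC4 hC5 hF hh5' Hh5 hp
    rcases he₅ with h | h
    · exfalso; rw [h] at hb5; omega
    · exact h
  subst E5
  have E6 : e₆ = 1 := by
    clear * - he₆ hb6 hC5 hC6 hF hh6' Hh6 hp
    rcases he₆ with h | h
    · exact h
    · exfalso; rw [h] at hb6; omega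
  subst E6
  have E7 : e₇ = 1 := by
    clear * - he₇ hb7 hC6 hC7 hF hh7' Hh7 hp
    rcases he₇ with h | h
    · exact h
    · exfalso; rw [h] at hb7; omega
  subst E7
  clear hb1 hb2 hb3 hb4 hb5 hb6 hb7 hC1 hC2 hC3 hC4 hC5 hC6 hC7
  -- the step times and the family hypotheses in the half variables (linear part of the system only)
  obtain ⟨-, -, -, -, -, -, -, L1, L2, L3, L4, L5, L6, L7, L8, L9, L10⟩ := hF
  have hq1 : p₁ = 2 * a0 + 1 := by
    clear * - L1 L2 L3 L4 L5 L6 L7 L8 L9 L10 hp hf' hh1' hh2' hh3' hh4' hh5' hh6' hh7' ha0 hd1 hd2 hd3 hd4 hd5 hd6 hd7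
        Hh1 Hh2 Hh3 Hh4 Hh5 Hh6 Hh7; omega
  have hq2 : p₂ = 4 * a0 + 1 := by
    clear * - L1 L2 L3 L4 L5 L6 L7 L8 L9 L10 hp hf' hh1' hh2' hh3' hh4' hh5' hh6' hh7' ha0 hd1 hd2 hd3 hd4 hd5 hd6 hd7
        Hh1 Hh2 Hh3 Hh4 Hh5 Hh6 Hh7; omega
  have hq3 : r₁ = 6 * a0 + 2 := by
    clear * - L1 L2 L3 L4 L5 L6 L7 L8 L9 L10 hp hf' hh1' hh2' hh3' hh4' hh5' hh6' hh7' ha0 hd1 hd2 hd3 hd4 hd5 hd6 hd7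
        Hh1 Hh2 Hh3 Hh4 Hh5 Hh6 Hh7; omega
  have hq4 : r₂ = 6 * a0 + 4 := by
    clear * - L1 L2 L3 L4 L5 L6 L7 L8 L9 L10 hp hf' hh1' hh2' hh3' hh4' hh5' hh6' hh7' ha0 hd1 hd2 hd3 hd4 hd5 hd6 hd7
        Hh1 Hh2 Hh3 Hh4 Hh5 Hh6 Hh7; omega
  have hq5 : p₃ = 2 * k + 4 * a0 + 3 := by
    clear * - L1 L2 L3 L4 L5 L6 L7 L8 L9 L10 hp hf' hh1' hh2' hh3' hh4' hh5' hh6' hh7' ha0 hd1 hd2 hd3 hd4 hd5 hd6 hd7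
        Hh1 Hh2 Hh3 Hh4 Hh5 Hh6 Hh7; omega
  have hq6 : p₄ = 4 * k + 2 * a0 + 1 := by
    clear * - L1 L2 L3 L4 L5 L6 L7 L8 L9 L10 hp hf' hh1' hh2' hh3' hh4' hh5' hh6' hh7' ha0 hd1 hd2 hd3 hd4 hd5 hd6 hd7
        Hh1 Hh2 Hh3 Hh4 Hh5 Hh6 Hh7; omega
  have hq7 : r₃ = 6 * k := by
    clear * - L1 L2 L3 L4 L5 L6 L7 L8 L9 L10 hp hf' hh1' hh2' hh3' hh4' hh5' hh6' hh7' ha0 hd1 hd2 hd3 hd4 hd5 hd6 hd7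
        Hh1 Hh2 Hh3 Hh4 Hh5 Hh6 Hh7; omega
  have hq8 : r₄ = 6 * k + 2 := by
    clear * - L1 L2 L3 L4 L5 L6 L7 L8 L9 L10 hp hf' hh1' hh2' hh3' hh4' hh5' hh6' hh7' ha0 hd1 hd2 hd3 hd4 hd5 hd6 hd7
        Hh1 Hh2 Hh3 Hh4 Hh5 Hh6 Hh7; omega
  have hG1 : 1 ≤ a0 := by
    clear * - L1 L2 L3 L4 L5 L6 L7 L8 L9 L10 hp hf' hh1' hh2' hh3' hh4' hh5' hh6' hh7' ha0 hd1 hd2 hd3 hd4 hd5 hd6 hd7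
        Hh1 Hh2 Hh3 Hh4 Hh5 Hh6 Hh7; omega
  have hG2 : a0 + 2 ≤ k := by
    clear * - L1 L2 L3 L4 L5 L6 L7 L8 L9 L10 hp hf' hh1' hh2' hh3' hh4' hh5' hh6' hh7' ha0 hd1 hd2 hd3 hd4 hd5 hd6 hd7
        Hh1 Hh2 Hh3 Hh4 Hh5 Hh6 Hh7; omega
  have heq : ω = s4j k a0 :=
    eq_tab_walk_of_forall hs
        (dduudduu4_table_j (k := k) (p := p₁) (t₂ := p₂) (t₃ := r₁) (t₄ := r₂) (t₅ := p₃) (t₆ := p₄) (t₇ := r₃)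
            (t₈ := r₄) (a := a0) hG1 hG2 hR0 hrun1 hrun2 hrun3 hrun4 hrun5 hrun6 hrun7 hR8 hq1 hq2 hq3 hq4 hq5 hq6
            hq7 hq8)
  exact ⟨a0, hG1, hG2, heq⟩

end Literature.Probability.RandomPlanarGeometry.SAW.HexBW.Wall
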